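import Mathlib.RingTheory.MvPolynomial.Basic
import Mathlib.Algebra.Algebra.Rat
import Mathlib.LinearAlgebra.Matrix.Determinant.Basic
import Mathlib.LinearAlgebra.Matrix.Notation
import Mathlib.Data.Set.Finite.Basic
import Mathlib.Algebra.BigOperators.Fin
import HarnessLib

/-!
# Generic finiteness of normalized central configurations, `n ≤ 5` (Jensen–Leykin 2025)

Topic `Literature/Dynamics/NBody`. NAMED FACT only (D-0014), no proof: the main computational
result of [JensenLeykin2025] (A. Jensen, A. Leykin, *Smale's 6th problem for generic masses*,
arXiv:2301.02305, J. Exp. Math.), typed for the `pub-smale6` cell.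

* §2.2 p. 2 (Albouy–Chenciner equations in mutual distances, after Hampton–Moeckel): variables
  `r_ij = r_ji` (`1 ≤ i ≠ j ≤ n`), `S_ij = r_ij⁻³ − 1`, `S_ii = 0`, `r_ii = 0`;
  `g_ij = Σ_k m_k S_ik (r_jk² − r_ik² − r_ij²)` (`n(n−1)` equations), `f_ij = g_ij + g_ji`.
* §2.3 p. 2: for `n ≥ 4` the Cayley–Menger determinant of every four bodies vanishes (planarity);
  for `n = 5` the system `F` is "20 + 10 + 5 = 35 equations in 10 unknowns" (§4.1 p. 5), the
  unknowns ranging over the torus (`r ∈ (K^*)^N`, §2.1; "a series r ∈ (K^*)^N with F(r) = 0").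
  The solutions of `F` are the paper's *normalized central configurations* (the normalization
  `λ' = −1` of Hampton–Moeckel is built into `S_ij = r_ij⁻³ − 1`).
* Conjecture 1, §2.4 p. 3, verbatim: "For generic values of masses, the number of normalized
  central configurations in the n-body problem over any field (of characteristic 0) is finite."
  followed by: "One exact meaning of “generic” is that the conclusion holds for a complement of a
  hypersurface (described by a polynomial in `m_1, …, m_n`) in the parameter space. It may be
  possible to obtain this hypersurface explicitly (e.g., see [5, Section 6] for `n = 4`) but that
  is much harder than the computation that confirms the conjecture, which we completed for `n ≤ 5`
  so far."  The mechanism (§2.4, §3 Proposition 1): masses `m_i = t^{v_i}` in the Puiseux field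
  `K = ℂ{{t}}`; if the tropical prevariety of `F` has pointed recession then `V(F) ⊂ (K^*)^N` is
  `0`-dimensional, and "the locus of points in the space of masses for which the dimension is not
  `0` would have to be contained in a proper subset cut out by polynomials with coefficients over
  `ℚ`".  §4.1 p. 5 ("Proof for five bodies"): with `m_i = t^{i²}` resp. `t^{3^{i−1}}` the recession
  fan is pointed (f-vectors `(3586, 12012, 18531, 15625, 7072, 1357)` resp.
  `(1506, 4744, 8586, 8787, 4652, 993)`); "Hence, the variety defined by `F` is zero-dimensional."
* §4.2 p. 6 (recorded here only as prose, NOT typed): masses of shape `(a, a, b, b, c)` "would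
  cover one of the components in the exceptional set of masses in [1]" (Albouy–Kaloshin) but
  "our method applied to this scenario … fails to confirm that the number of central
  configurations is finite."

Encoding. Distances are a function `r : Fin n → Fin n → K` required to be symmetric, zero on the
diagonal and nonzero off it (the torus condition); `K` is any field of characteristic zero (the
conjecture's "any field (of characteristic 0)"; `ℚ`-algebra structure from `CharZero`).  The
generic-masses clause is typed exactly as the paper's "exact meaning": a nonzero rational
polynomial `P(m_1,…,m_n)` off whose zero set the solution set is finite.  `f_ij = g_ij + g_ji` is
omitted from the defining conditions (it is implied by them).  Only `n = 5` (and the weaker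
`n = 4`, also covered by "n ≤ 5") are asserted as facts; the predicate `jlGenericFiniteness n`
for `n ≥ 6` is the paper's unproved displayed statement 1 and is deliberately NOT a fact here
(it would be an obligation under `Summits/…`, gate rule `literature.conjecture`).

Deliberately NOT here: Proposition 1 / Bieri–Groves (tropical geometry is not in Mathlib), the
f-vectors as data, the relation to real positive central configurations (a real planar central
configuration with positive masses, normalized as in Hampton–Moeckel, gives a point of this set
with `K = ℝ`; that dictionary is the cell's business, not the paper's statement).
-/

namespace Literature.Dynamics.NBody

/-- Mutual-distance data on the torus: `r_ij = r_ji`, `r_ii = 0`, `r_ij ≠ 0` for `i ≠ j`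
(`r ∈ (K^*)^N`, `N = n(n−1)/2`). [cite: JensenLeykin2025, §2.1–2.2 p. 2] -/
def IsTorusDistanceData {K : Type*} [Field K] {n : ℕ} (r : Fin n → Fin n → K) : Prop :=
  (∀ i j, r i j = r j i) ∧ (∀ i, r i i = 0) ∧ (∀ i j, i ≠ j → r i j ≠ 0)

/-- `S_ij = r_ij⁻³ − 1` (`i ≠ j`), `S_ii = 0`. [cite: JensenLeykin2025, §2.2 p. 2] -/
def jlS {K : Type*} [Field K] {n : ℕ} (r : Fin n → Fin n → K) (i j : Fin n) : K :=
  if i = j then 0 else (r i j)⁻¹ ^ 3 - 1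

/-- The Albouy–Chenciner / Hampton–Moeckel polynomial
`g_ij = Σ_k m_k S_ik (r_jk² − r_ik² − r_ij²)`. [cite: JensenLeykin2025, §2.2 p. 2] -/
def jlG {K : Type*} [Field K] {n : ℕ} (m : Fin n → K) (r : Fin n → Fin n → K) (i j : Fin n) : K :=
  ∑ k, m k * jlS r i k * (r j k ^ 2 - r i k ^ 2 - r i j ^ 2)

/-- Cayley–Menger determinant of four bodies `a, b, c, d` (bordered `5 × 5` determinant of squared
distances); its vanishing expresses that the four bodies are coplanar.
[cite: JensenLeykin2025, §2.3 p. 2] -/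
def cayleyMenger4 {K : Type*} [Field K] {n : ℕ} (r : Fin n → Fin n → K) (a b c d : Fin n) : K :=
  Matrix.det !![0, 1, 1, 1, 1;
                1, 0, r a b ^ 2, r a c ^ 2, r a d ^ 2;
                1, r a b ^ 2, 0, r b c ^ 2, r b d ^ 2;
                1, r a c ^ 2, r b c ^ 2, 0, r c d ^ 2;
                1, r a d ^ 2, r b d ^ 2, r c d ^ 2, 0]

/-- The paper's *normalized central configurations* of `n` bodies with masses `m` over the field
`K`: torus points `r` with `g_ij(r) = 0` for all `i ≠ j` and all four-body Cayley–Menger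
determinants zero (system `F` of §4.1: `n(n−1)` `g`'s, the implied `f`'s, `C(n,4)` determinants).
[cite: JensenLeykin2025, §2.2–2.3 p. 2; §4.1 p. 5] -/
def jlNormalizedCCs (K : Type*) [Field K] {n : ℕ} (m : Fin n → K) : Set (Fin n → Fin n → K) :=
  {r | IsTorusDistanceData r ∧ (∀ i j, i ≠ j → jlG m r i j = 0) ∧
    (∀ a b c d : Fin n, a ≠ b → a ≠ c → a ≠ d → b ≠ c → b ≠ d → c ≠ d →
      cayleyMenger4 r a b c d = 0)}

/-- PREDICATE (a `Prop`-valued definition for every `n`, not itself a fact): generic finiteness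
of normalized central configurations of `n` bodies in the paper's "exact meaning" of generic —
there is a nonzero polynomial `P ∈ ℚ[m_1,…,m_n]` such that for every field `K` of characteristic
`0` and all masses `m ∈ Kⁿ` with `P(m) ≠ 0` the set of normalized central configurations is
finite.  [JensenLeykin2025] proves it for `n ≤ 5` (§4.1); it is asserted as a named fact below
ONLY for `n = 5` and `n = 4`.  [cite: JensenLeykin2025, §2.4 p. 3 (displayed statement 1 and the
sentence "One exact meaning of generic …")] -/
def jlGenericFiniteness (n : ℕ) : Prop :=
  ∃ P : MvPolynomial (Fin n) ℚ, P ≠ 0 ∧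
    ∀ (K : Type) [Field K] [CharZero K] (m : Fin n → K),
      MvPolynomial.aeval m P ≠ 0 → (jlNormalizedCCs K m).Finite

/-- NAMED FACT, THEOREM OF THE PAPER (§4.1 "Proof for five bodies": a gfan tropical-prevariety
computation whose recession fan is pointed, combined with Proposition 1 §3): generic finiteness of
normalized central configurations holds for five bodies.
[cite: JensenLeykin2025, §4.1 p. 5; abstract p. 1 "completed for n ≤ 5"] -/
def jensenLeykin2025_genericFiniteness_five : Prop := jlGenericFiniteness 5

/-- NAMED FACT, THEOREM OF THE PAPER: generic finiteness of normalized central configurations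
holds for four bodies (abstract: "completed for n ≤ 5"; for `n = 4` already the trivial valuation
reproduces Hampton–Moeckel's count, §4.2). [cite: JensenLeykin2025, abstract p. 1; §4.2 p. 6] -/
def jensenLeykin2025_genericFiniteness_four : Prop := jlGenericFiniteness 4

/-- Non-vacuity of the encoding: for three bodies the "equilateral" torus point `r_ij = 1`
(`i ≠ j`) is a normalized central configuration for ALL masses (every `S_ij` vanishes and there is
no four-body Cayley–Menger condition) — Lagrange's solution in this normalization. [folklore] -/
theorem jlNormalizedCCs_three_equilateral (K : Type*) [Field K] (m : Fin 3 → K) :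
    (fun i j : Fin 3 => if i = j then (0 : K) else 1) ∈ jlNormalizedCCs K m := by
  refine ⟨⟨?_, ?_, ?_⟩, ?_, ?_⟩
  · intro i j
    by_cases h : i = j
    · subst h; rfl
    · simp [h, Ne.symm h]
  · intro i; simp
  · intro i j hij; simp [hij]
  · intro i j hij
    unfold jlG
    apply Finset.sum_eq_zero
    intro k _
    unfold jlS
    by_cases hik : i = k
    · simp [hik]
    · simp [hik]
  · intro a b c d hab hac had hbc hbd hcd
    exfalso
    fin_cases a <;> fin_cases b <;> fin_cases c <;> fin_cases d <;> simp_all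

end Literature.Dynamics.NBody
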